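import Literature.NumberTheory.Automorphic.ArchSobolevGL
import Literature.NumberTheory.Automorphic.HarishChandraGrowthGL
import Literature.NumberTheory.Automorphic.AutomorphicRepsGLCuspFormsRapidDecaySiegel
import Literature.NumberTheory.Automorphic.SelfDualUnitsInstances
import HarnessLib

/-!
# Elements of stable spaces of automorphic forms on `GL_n(𝔸_K)` have uniformly moderate growth

Topic `NumberTheory/Automorphic`; sequel of `ArchAPrioriGL` (the a-priori estimate for the weighted
local `L²`-norms of the derivatives) and `ArchSobolevGL` (the Sobolev box lemma). Main result:

* `IsStableSubmodule.hasUniformModerateGrowth_of_mem`: if `W` is a `(𝔤, K_∞) × GL_n(𝔸_K^∞)`-stable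
  space of automorphic forms (`IsStableSubmodule (AutomorphyDatum.gl n K hcpt) W`) and `φ ∈ W`,
  then `φ` has uniformly moderate growth (`HasUniformModerateGrowth`: ONE exponent `r` with
  `‖(p φ)(g)‖ ≤ C_p (1 ⊔ ‖g‖)^r` for every `p ∈ ℝ⟨𝔤⟩`).

This is Borel–Jacquet 1979, 4.3 (ii) / Moeglin–Waldspurger 1995, I.2.17 for the elements of stable
spaces, PROVED here without Harish-Chandra's convolution identity `φ = φ ∗ α` and without elliptic
regularity, by Nelson's method run a priori:

1. (`exists_norm_cutoffWeightMap_zero_le`) the weight-`0` local `L²`-norms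
   `‖χ · u(y ·)‖_{L²}` of the elements `u` of a finite-dimensional `T ≤ W` grow like
   `(1 ⊔ ‖y‖)^r · size(u)` (moderate growth of a basis of `T`);
2. `T ∋ φ` is chosen stable under Nelson's Laplacian `Δ = ∑_p X_p²` of the unit generators
   (`IsStableSubmodule.exists_laplacian_stable`: `Z(𝔤)`- and `K_∞`-finiteness), so the a-priori
   estimate `exists_norm_cutoffWeightMap_wordEnd_le` bounds the weighted local norms of ALL the
   derivatives `X_β φ` (words in the unit generators) by the weight-`0` norms on `T`;
   words in arbitrary letters reduce to these (`exists_norm_cutoffWeightMap_iterW_le`);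
3. the Sobolev box lemma `exists_norm_le_sum_cutoffWeightLp_sq` turns the local `L²` bounds of the
   derivatives into pointwise bounds (`exists_exponent_norm_iterLieDeriv_le`).

With the rapid decay of uniformly-moderate-growth cusp forms
(`IsCuspFormGL.isRapidlyDecreasingGL_of_hasUniformModerateGrowth`) this gives the boundedness and
square-integrability of the elements of stable spaces of cusp forms, and Harish-Chandra's
analyticity `cuspidal_analyticAt_rightRegular` unconditionally (sequel
`AutomorphicRepsGLIrreducibleL2HCProofs`).

## References

* A. Borel, H. Jacquet, *Automorphic forms and automorphic representations*, Proc. Sympos. Pure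
  Math. 33 (1979), Part 1, 4.3 [BorelJacquetCorvallis1979].
* C. Moeglin, J.-L. Waldspurger, *Spectral decomposition and Eisenstein series* (1995), I.2.17.
* E. Nelson, *Analytic vectors*, Ann. of Math. 70 (1959), §6, §8 [Nelson1959].
* Harish-Chandra, *Representations of a semisimple Lie group on a Banach space. I*, Trans. AMS 75
  (1953), Lemma 34 [HarishChandraTAMS1953] (held): the application.
-/

noncomputable section

open scoped MatrixGroups Matrix ContDiff Topology Classical ENNReal InnerProductSpace
open Filter MeasureTheory NumberField NumberField.mixedEmbedding IsDedekindDomain Set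

namespace Literature.NumberTheory.Automorphic

-- `M_n(K_∞)` is finite-dimensional over `ℝ` (a theorem used as a local instance, as in
-- `TestFunctionLieDeriv`)
attribute [local instance] finiteDimensional_matrix_mixedSpace

-- Mathlib idiom (Mathlib/Algebra/Lie/OfAssociative.lean); needed to mention Lie subalgebras of matrix algebras
attribute [local instance 100] LieRing.ofAssociativeRing

-- the scoped operator norm on `𝔤𝔩_n(K_∞)`, as in `ArchimedeanCalculus`
open scoped Matrix.Norms.Operator

variable {n : ℕ} {K : Type} [Field K] [NumberField K] {hcpt : isCompact_glFiniteIntegralLevel n K}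
  {W : Submodule ℂ ((AdelicGroupData.gl n K).Adelic → ℂ)}

/-! ### 1. Continuity of the elements of a stable space; the weight maps -/

/-- Elements of a stable space of automorphic forms on `GL_n(𝔸_K)` are continuous. [folklore] -/
theorem IsStableSubmodule.continuous_of_mem_gl (hW : IsStableSubmodule (AutomorphyDatum.gl n K hcpt) W) :
    ∀ φ ∈ W, Continuous φ := fun _ hφ ↦
  continuous_of_mem_automorphicForms_gl (hW.le_automorphicForms hφ)

/-! ### 2. The local bound `Λ(y)`: the weight-`0` norms on `T` grow polynomially in the height of `y` -/

/-- The compact set of `GL_n(K_∞)` carrying the cut-off: the units attached to `tsupport χ`. [folklore] -/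
theorem isCompact_cutoffUnits :
    IsCompact ((fun s : GlIdx n K → ℝ ↦ (glUnitChart n K).symm (matOf s)) '' tsupport (glCutoffC n K)) :=
  (hasCompactSupport_glCutoffC (n := n) (K := K)).image_of_continuousOn
    (continuousOn_glUnitChart_symm_matOf.mono tsupport_glCutoffC_subset)

/-- **The local bound.** Let `W` be a stable space of automorphic forms on `GL_n(𝔸_K)` and `bT` a
finite basis of a subspace `T ≤ W`. There are `r : ℕ` and `Λ₀ ≥ 0` such that for all
`y ∈ GL_n(𝔸_K)` and `u ∈ T`,
`‖cutoffWeightMap 0 y u‖ ≤ Λ₀ (1 ⊔ ‖y‖)^r · coordSize bT u` (moderate growth of the basis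
elements, expansion `u = ∑ cⱼ bⱼ` with `|cⱼ| ≤ coordSize`, the height bound
`1 ⊔ ‖y x‖ ≤ (1 ⊔ n ‖x‖)(1 ⊔ ‖y‖)` on the compact set carrying the cut-off, and `0 ≤ χ ≤ 1`).
[folklore] -/
theorem exists_norm_cutoffWeightMap_zero_le (hW : IsStableSubmodule (AutomorphyDatum.gl n K hcpt) W)
    {T : Submodule ℂ W} {ιT : Type*} [Fintype ιT] (bT : Module.Basis ιT ℂ T) :
    ∃ (r : ℕ) (Λ₀ : ℝ), 0 ≤ Λ₀ ∧ ∀ (y : (AdelicGroupData.gl n K).Adelic), ∀ u ∈ T,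
      ‖cutoffWeightMap hcpt hW.continuous_of_mem_gl 0 y u‖ ≤
        (Λ₀ * (1 ⊔ (AutomorphyDatum.gl n K hcpt).height y) ^ r) * coordSize bT u := by
  -- moderate growth of the basis elements
  have hmg : ∀ j : ιT, HasModerateGrowth (AutomorphyDatum.gl n K hcpt) (((bT j : T) : W) : (AdelicGroupData.gl n K).Adelic → ℂ) :=
    fun j ↦ (hW.isAutomorphicForm_of_mem ((bT j : T) : W).2).moderateGrowth
  choose C r hCr using hmg
  have hC0 : ∀ j, 0 ≤ C j := fun j ↦ by
    have h := hCr j 1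
    have hpos : (0 : ℝ) < (1 ⊔ (AutomorphyDatum.gl n K hcpt).height 1) ^ (r j) :=
      pow_pos (lt_of_lt_of_le one_pos le_sup_left) _
    exact nonneg_of_mul_nonneg_left ((norm_nonneg _).trans h) hpos
  -- a common exponent
  set R : ℕ := ∑ j, r j with hR
  have hrR : ∀ j, r j ≤ R := fun j ↦ Finset.single_le_sum (f := r) (fun _ _ ↦ Nat.zero_le _) (Finset.mem_univ j)
  -- the compact set carrying the cut-off and the height bound on it
  obtain ⟨B, hB0, hB⟩ := exists_adelicHeightGL_ofInfinite_le_of_isCompact (isCompact_cutoffUnits (n := n) (K := K))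
  set D : ℝ := 1 ⊔ n * B with hD
  have hD1 : 1 ≤ D := le_sup_left
  -- the `L²` class of the cut-off
  have hχm : MemLp (glCutoffC n K) 2 (volume : Measure (GlIdx n K → ℝ)) :=
    continuous_glCutoffC.memLp_of_hasCompactSupport hasCompactSupport_glCutoffC
  have hD0 : 0 ≤ D := le_trans zero_le_one hD1
  refine ⟨R, (∑ j, C j) * D ^ R * ‖hχm.toLp _‖,
    mul_nonneg (mul_nonneg (Finset.sum_nonneg fun j _ ↦ hC0 j) (pow_nonneg hD0 _)) (norm_nonneg _), fun y u hu ↦ ?_⟩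
  have hy1 : (1 : ℝ) ≤ 1 ⊔ (AutomorphyDatum.gl n K hcpt).height y := le_sup_left
  -- pointwise bound of the elements of `T` in terms of the size
  have hpt : ∀ x : (AdelicGroupData.gl n K).Adelic, ‖(u : (AdelicGroupData.gl n K).Adelic → ℂ) x‖ ≤
      coordSize bT u * ∑ j, C j * (1 ⊔ (AutomorphyDatum.gl n K hcpt).height x) ^ R := by
    intro x
    have hx1 : (1 : ℝ) ≤ 1 ⊔ (AutomorphyDatum.gl n K hcpt).height x := le_sup_left
    have e := congrArg (fun v : W ↦ (v : (AdelicGroupData.gl n K).Adelic → ℂ) x) (eq_sum_coord_smul_basis bT hu)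
    simp only [Submodule.coe_sum, Submodule.coe_smul, Finset.sum_apply, Pi.smul_apply, smul_eq_mul] at e
    rw [e, Finset.mul_sum]
    refine (norm_sum_le _ _).trans (Finset.sum_le_sum fun j _ ↦ ?_)
    rw [norm_mul]
    calc ‖bT.equivFun ⟨u, hu⟩ j‖ * ‖(((bT j : T) : W) : (AdelicGroupData.gl n K).Adelic → ℂ) x‖
        ≤ coordSize bT u * (C j * (1 ⊔ (AutomorphyDatum.gl n K hcpt).height x) ^ (r j)) :=
          mul_le_mul (norm_coord_le_coordSize bT hu j) (hCr j x) (norm_nonneg _) (coordSize_nonneg bT u)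
      _ ≤ coordSize bT u * (C j * (1 ⊔ (AutomorphyDatum.gl n K hcpt).height x) ^ R) := by
          refine mul_le_mul_of_nonneg_left (mul_le_mul_of_nonneg_left ?_ (hC0 j)) (coordSize_nonneg bT u)
          exact pow_le_pow_right₀ hx1 (hrR j)
  -- pointwise bound of the weight-`0` function by a multiple of the cut-off
  have hle : ∀ s, ‖cutoffWeight hcpt 0 y (u : (AdelicGroupData.gl n K).Adelic → ℂ) s‖ ≤
      (coordSize bT u * ((∑ j, C j) * D ^ R * (1 ⊔ (AutomorphyDatum.gl n K hcpt).height y) ^ R)) *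
        ‖glCutoffC n K s‖ := by
    intro s
    rw [cutoffWeight_apply, zero_add, pow_one, norm_mul, mul_comm]
    by_cases hs : s ∈ tsupport (glCutoffC n K)
    · have hsU : s ∈ glUnitSet n K := tsupport_glCutoffC_subset hs
      refine mul_le_mul_of_nonneg_right ?_ (norm_nonneg _)
      rw [orbitPull_of_mem hcpt y _ hsU]
      set g : GL (Fin n) (mixedSpace K) := (glUnitChart n K).symm (matOf s) with hg
      have hgS : g ∈ (fun s : GlIdx n K → ℝ ↦ (glUnitChart n K).symm (matOf s)) '' tsupport (glCutoffC n K) :=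
        ⟨s, hs, rfl⟩
      refine (hpt _).trans (mul_le_mul_of_nonneg_left ?_ (coordSize_nonneg bT u))
      rw [Finset.sum_mul, Finset.sum_mul]
      refine Finset.sum_le_sum fun j _ ↦ ?_
      rw [mul_assoc]
      refine mul_le_mul_of_nonneg_left ?_ (hC0 j)
      rw [← mul_pow]
      refine pow_le_pow_left₀ (le_trans zero_le_one le_sup_left) ?_ R
      rw [AutomorphyDatum.gl_height]
      refine (one_sup_adelicHeightGL_mul_le y _).trans (mul_le_mul_of_nonneg_right ?_
        (le_trans zero_le_one le_sup_left))
      exact sup_le_sup_left (mul_le_mul_of_nonneg_left (hB g hgS) (Nat.cast_nonneg n)) _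
    · have h0 : glCutoffC n K s = 0 := image_eq_zero_of_notMem_tsupport hs
      rw [h0, norm_zero, mul_zero, mul_zero]
  -- the `L²` comparison
  rw [cutoffWeightMap_apply, cutoffWeightLp]
  calc ‖(memLp_cutoffWeight hcpt 0 y (hW.continuous_of_mem_gl u u.2)).toLp _‖
      ≤ (coordSize bT u * ((∑ j, C j) * D ^ R * (1 ⊔ (AutomorphyDatum.gl n K hcpt).height y) ^ R)) * ‖hχm.toLp _‖ := by
        refine Lp.norm_le_mul_norm_of_ae_le_mul ?_
        filter_upwards [(memLp_cutoffWeight hcpt 0 y (hW.continuous_of_mem_gl u u.2)).coeFn_toLp, hχm.coeFn_toLp]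
          with s h1 h2
        rw [h1, h2]
        exact hle s
    _ = _ := by ring


/-! ### 3. Words in arbitrary letters: reduction to words in the unit generators -/

section Reduction

variable (hW : IsStableSubmodule (AutomorphyDatum.gl n K hcpt) W) {Sι : Type*} [Fintype Sι] (F : SelfDualUnits (mixedSpace K) Sι)

/-- The unit generators read in the Lie algebra of the `GL_n` datum. [folklore] -/
def unitGenD (hcpt : isCompact_glFiniteIntegralLevel n K) (p : Sι × Fin n × Fin n) : (AutomorphyDatum.gl n K hcpt).arch.lie := unitGen F p

/-- The element of `W` given by an iterated Lie derivative of an element of `W`. [folklore] -/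
def IsStableSubmodule.iterW (L : List (AutomorphyDatum.gl n K hcpt).arch.lie) (φ : W) : W :=
  ⟨iterLieDeriv (AutomorphyDatum.gl n K hcpt).ofArch L φ, hW.isLieStableSmooth_gl.iterLieDeriv_mem L φ.2⟩

/-- Unfolding of `iterW`. [folklore] -/
@[simp] theorem IsStableSubmodule.coe_iterW (L : List (AutomorphyDatum.gl n K hcpt).arch.lie) (φ : W) :
    ((hW.iterW L φ : W) : (AdelicGroupData.gl n K).Adelic → ℂ) = iterLieDeriv (AutomorphyDatum.gl n K hcpt).ofArch L φ := rfl

/-- A word in the unit generators applied through `lieRep` is `iterW` of the word. [folklore] -/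
theorem IsStableSubmodule.wordEnd_eq_iterW (β : List (Sι × Fin n × Fin n)) (φ : W) :
    Literature.Analysis.OperatorTheory.wordEnd
        (fun p ↦ hW.isLieStableSmooth_gl.lieRep (archGroupGL_lie n K) (archGroupGL_carrier n K) (unitGen F p)) β φ =
      hW.iterW (β.map (unitGenD F hcpt)) φ := by
  apply Subtype.ext
  rw [IsStableSubmodule.coe_iterW, Literature.Analysis.OperatorTheory.wordEnd,
    ← hW.isLieStableSmooth_gl.coe_lieRep_prod (archGroupGL_lie n K) (archGroupGL_carrier n K), List.map_map]
  rfl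

/-- **Peeling an arbitrary letter**: `iterW (βu ++ Y :: Ys) φ = ∑_p y_p • iterW ((β ++ [p])u ++ Ys) φ`
where `Y = ∑ y_p X_p` in the unit generators (linearity of the Lie derivative in the letter on smooth
functions, and of the iterated derivative in the function). [folklore] -/
theorem IsStableSubmodule.iterW_append_cons_eq_sum (β : List (Sι × Fin n × Fin n)) (Y : (AutomorphyDatum.gl n K hcpt).arch.lie)
    (Ys : List (AutomorphyDatum.gl n K hcpt).arch.lie) (φ : W) {x : Sι × Fin n × Fin n → ℝ} (hx : Y = ∑ p, x p • unitGen F p) :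
    hW.iterW (β.map (unitGenD F hcpt) ++ Y :: Ys) φ =
      ∑ p, (x p : ℂ) • hW.iterW ((β ++ [p]).map (unitGenD F hcpt) ++ Ys) φ := by
  have h := hW.isLieStableSmooth_gl
  apply Subtype.ext
  rw [IsStableSubmodule.coe_iterW, Submodule.coe_sum, iterLieDeriv_append, iterLieDeriv_cons]
  have hsm : IsArchSmooth (AutomorphyDatum.gl n K hcpt).ofArch (iterLieDeriv (AutomorphyDatum.gl n K hcpt).ofArch Ys (φ : (AdelicGroupData.gl n K).Adelic → ℂ)) :=
    h.smooth _ (h.iterLieDeriv_mem Ys φ.2)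
  have hlin : lieDeriv (AutomorphyDatum.gl n K hcpt).ofArch Y (iterLieDeriv (AutomorphyDatum.gl n K hcpt).ofArch Ys (φ : (AdelicGroupData.gl n K).Adelic → ℂ)) =
      ∑ p, x p • lieDeriv (AutomorphyDatum.gl n K hcpt).ofArch (unitGenD F hcpt p) (iterLieDeriv (AutomorphyDatum.gl n K hcpt).ofArch Ys (φ : (AdelicGroupData.gl n K).Adelic → ℂ)) := by
    rw [hx]
    exact hsm.lieDeriv_sum_smul_left (AutomorphyDatum.gl n K hcpt).ofArch Finset.univ x (fun p ↦ unitGenD F hcpt p)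
  have e : (∑ p, x p • lieDeriv (AutomorphyDatum.gl n K hcpt).ofArch (unitGenD F hcpt p) (iterLieDeriv (AutomorphyDatum.gl n K hcpt).ofArch Ys (φ : (AdelicGroupData.gl n K).Adelic → ℂ))) =
      ∑ p, (x p : ℂ) • lieDeriv (AutomorphyDatum.gl n K hcpt).ofArch (unitGenD F hcpt p) (iterLieDeriv (AutomorphyDatum.gl n K hcpt).ofArch Ys (φ : (AdelicGroupData.gl n K).Adelic → ℂ)) :=
    Finset.sum_congr rfl fun p _ ↦ real_smul_fun_eq_coe_smul _ _
  have hsum : iterLieDeriv (AutomorphyDatum.gl n K hcpt).ofArch (β.map (unitGenD F hcpt))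
      (∑ p, (x p : ℂ) • lieDeriv (AutomorphyDatum.gl n K hcpt).ofArch (unitGenD F hcpt p) (iterLieDeriv (AutomorphyDatum.gl n K hcpt).ofArch Ys (φ : (AdelicGroupData.gl n K).Adelic → ℂ))) =
      ∑ p, (x p : ℂ) • iterLieDeriv (AutomorphyDatum.gl n K hcpt).ofArch (β.map (unitGenD F hcpt))
        (lieDeriv (AutomorphyDatum.gl n K hcpt).ofArch (unitGenD F hcpt p) (iterLieDeriv (AutomorphyDatum.gl n K hcpt).ofArch Ys (φ : (AdelicGroupData.gl n K).Adelic → ℂ))) :=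
    iterLieDeriv_finset_sum_smul (β.map (unitGenD F hcpt)) Finset.univ (fun p ↦ (x p : ℂ))
      (fun p ↦ h.smooth _ (h.lie_mem _ _ (h.iterLieDeriv_mem Ys φ.2)))
  rw [hlin, e, hsum]
  refine Finset.sum_congr rfl fun p _ ↦ ?_
  simp only [Submodule.coe_smul, IsStableSubmodule.coe_iterW, List.map_append, List.map_cons, List.map_nil,
    List.append_assoc, List.singleton_append, iterLieDeriv_append, iterLieDeriv_cons]

/-- **Bounds for words in arbitrary letters from bounds for words in the unit generators.** Let
`T ≤ W` (finite basis `bT`) be stable under Nelson's Laplacian of the unit generators, `Λ` a local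
bound (`‖M_0^{(y)} u‖ ≤ Λ y · size u` on `T`), `φ ∈ T` and `m ∈ ℕ`. Then for every list `Ys` of
elements of `𝔤` and every word `β` in the unit generators with `|β| + |Ys| ≤ m` there is `Kc ≥ 0`
with `‖M_m^{(y)} (β Ys φ)‖ ≤ Kc Λ y · size φ` for all `y` (induction on `Ys`: expand the first
letter in the unit generators, `iterW_append_cons_eq_sum`, and use the a-priori estimate
`exists_norm_cutoffWeightMap_wordEnd_le` for pure words). [folklore] -/
theorem IsStableSubmodule.exists_norm_cutoffWeightMap_iterW_le {T : Submodule ℂ W} {ιT : Type*} [Fintype ιT]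
    (bT : Module.Basis ιT ℂ T)
    (hT : ∀ u ∈ T, (∑ p : Sι × Fin n × Fin n,
      hW.isLieStableSmooth_gl.lieRep (archGroupGL_lie n K) (archGroupGL_carrier n K) (unitGen F p) *
        hW.isLieStableSmooth_gl.lieRep (archGroupGL_lie n K) (archGroupGL_carrier n K) (unitGen F p)) u ∈ T)
    {Λ : (AdelicGroupData.gl n K).Adelic → ℝ} (hΛ0 : ∀ y, 0 ≤ Λ y)
    (hΛ : ∀ y, ∀ u ∈ T, ‖cutoffWeightMap hcpt hW.continuous_of_mem_gl 0 y u‖ ≤ Λ y * coordSize bT u)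
    {φ : W} (hφ : φ ∈ T) (m : ℕ) :
    ∀ (Ys : List (AutomorphyDatum.gl n K hcpt).arch.lie) (β : List (Sι × Fin n × Fin n)), β.length + Ys.length ≤ m →
      ∃ Kc : ℝ, 0 ≤ Kc ∧ ∀ y : (AdelicGroupData.gl n K).Adelic,
        ‖cutoffWeightMap hcpt hW.continuous_of_mem_gl m y (hW.iterW (β.map (unitGenD F hcpt) ++ Ys) φ)‖ ≤
          Kc * Λ y * coordSize bT φ := by
  intro Ys
  induction Ys with
  | nil =>
    intro β hβ
    rw [List.length_nil, add_zero] at hβ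
    obtain ⟨C, hC0, hC⟩ := exists_norm_cutoffWeightMap_wordEnd_le hcpt hW.isLieStableSmooth_gl hW.continuous_of_mem_gl
      F bT hT β.length m hβ
    refine ⟨C, hC0, fun y ↦ ?_⟩
    rw [List.append_nil, ← hW.wordEnd_eq_iterW F β φ]
    exact hC y (Λ y) (hΛ0 y) (hΛ y) β rfl φ hφ
  | cons Y Ys ih =>
    intro β hβ
    obtain ⟨x, hx⟩ := exists_repr_unitGen F Y
    have hlen : ∀ p, (β ++ [p]).length + Ys.length ≤ m := fun p ↦ by
      rw [List.length_append, List.length_singleton]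
      rw [List.length_cons] at hβ
      omega
    choose Kc hKc0 hKc using fun p : Sι × Fin n × Fin n ↦ ih (β ++ [p]) (hlen p)
    refine ⟨∑ p, |x p| * Kc p, Finset.sum_nonneg fun p _ ↦ mul_nonneg (abs_nonneg _) (hKc0 p), fun y ↦ ?_⟩
    rw [hW.iterW_append_cons_eq_sum F β Y Ys φ hx, map_sum]
    refine (norm_sum_le _ _).trans ?_
    rw [Finset.sum_mul, Finset.sum_mul]
    refine Finset.sum_le_sum fun p _ ↦ ?_
    rw [map_smul, _root_.norm_smul, Complex.norm_real, Real.norm_eq_abs, mul_assoc, mul_assoc]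
    exact mul_le_mul_of_nonneg_left (by rw [← mul_assoc]; exact hKc p y) (abs_nonneg _)

end Reduction

/-! ### 4. Uniform moderate growth of the elements of stable spaces -/

section Growth

/-- `cutoffWeightLp` only depends on the function. [folklore] -/
theorem cutoffWeightLp_congr (m : ℕ) (y : (AdelicGroupData.gl n K).Adelic)
    {f g : (AdelicGroupData.gl n K).Adelic → ℂ} (hf : Continuous f) (hg : Continuous g) (e : f = g) :
    cutoffWeightLp hcpt m y hf = cutoffWeightLp hcpt m y hg := by
  subst e; rfl

/-- The word of a finite set of coordinates has as many letters as the set has elements. [folklore] -/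
theorem length_wordOfFinset (hcpt : isCompact_glFiniteIntegralLevel n K) (S : Finset (GlIdx n K)) :
    (wordOfFinset hcpt S).length = S.card := by
  rw [wordOfFinset, List.length_reverse, List.length_map, Finset.length_sort]

/-- **Pointwise bounds for the iterated derivatives of an element of a stable space.** Let `W` be a
stable space of automorphic forms on `GL_n(𝔸_K)` and `φ ∈ W`. There is `r : ℕ` such that for every
list `L` of elements of `𝔤` there is `B` with `‖(L φ)(g)‖ ≤ B (1 ⊔ ‖g‖)^r` for all `g` — ONE
exponent for all derivatives. Proof: `φ` lies in a finite-dimensional `T ≤ W` stable under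
Nelson's Laplacian of the unit generators (`IsStableSubmodule.exists_laplacian_stable`); the
Sobolev box lemma (`exists_norm_le_sum_cutoffWeightLp_sq`) bounds `‖(L φ)(y)‖` by the weighted
local `L²`-norms of the derivatives `X_S L φ`, which by the reduction to pure words
(`exists_norm_cutoffWeightMap_iterW_le`) and the a-priori estimate are bounded by the weight-`0`
norms on `T`, and these grow like `(1 ⊔ ‖y‖)^r` (`exists_norm_cutoffWeightMap_zero_le`).
[folklore] -/
theorem IsStableSubmodule.exists_exponent_norm_iterLieDeriv_le (hW : IsStableSubmodule (AutomorphyDatum.gl n K hcpt) W)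
    {φ : (AdelicGroupData.gl n K).Adelic → ℂ} (hφ : φ ∈ W) :
    ∃ r : ℕ, ∀ L : List (AutomorphyDatum.gl n K hcpt).arch.lie, ∃ B : ℝ, ∀ g : (AdelicGroupData.gl n K).Adelic,
      ‖iterLieDeriv (AutomorphyDatum.gl n K hcpt).ofArch L φ g‖ ≤ B * (1 ⊔ (AutomorphyDatum.gl n K hcpt).height g) ^ r := by
  have h := hW.isLieStableSmooth_gl
  have hWc := hW.continuous_of_mem_gl
  -- the `Δ`-stable finite-dimensional `T` through `φ` and its basis
  obtain ⟨T, hTfin, hφT, hT⟩ := hW.exists_laplacian_stable (SelfDualUnits.mixedSpace K) ⟨φ, hφ⟩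
  haveI := hTfin
  haveI : Module.Free ℂ T := Module.Free.of_divisionRing ℂ T
  let bT := Module.finBasis ℂ T
  -- the local bound and the Sobolev constant
  obtain ⟨r, Λ₀, hΛ₀, hΛ⟩ := exists_norm_cutoffWeightMap_zero_le hW bT
  obtain ⟨Csob, hCsob0, hsob⟩ := exists_norm_le_sum_cutoffWeightLp_sq hcpt
  refine ⟨2 * r, fun L ↦ ?_⟩
  -- the derivative `G = L φ` and its words
  have hGW : iterLieDeriv (AutomorphyDatum.gl n K hcpt).ofArch L φ ∈ W := h.iterLieDeriv_mem L hφ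
  have hGsm : IsArchSmooth (AutomorphyDatum.gl n K hcpt).ofArch (iterLieDeriv (AutomorphyDatum.gl n K hcpt).ofArch L φ) := h.smooth _ hGW
  have hGc : ∀ L' : List (AutomorphyDatum.gl n K hcpt).arch.lie, Continuous (iterLieDeriv (AutomorphyDatum.gl n K hcpt).ofArch L' (iterLieDeriv (AutomorphyDatum.gl n K hcpt).ofArch L φ)) :=
    fun L' ↦ by rw [← iterLieDeriv_append]; exact hWc _ (h.iterLieDeriv_mem _ hφ)
  -- the weight level and the reduction constants, one per subset of coordinates
  obtain ⟨m, hm⟩ : ∃ m : ℕ, m = Module.finrank ℝ (Matrix (Fin n) (Fin n) (mixedSpace K)) + L.length := ⟨_, rfl⟩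
  have hlen : ∀ S : Finset (GlIdx n K),
      ([] : List (({w : InfinitePlace K // w.IsReal} × Unit) ⊕ ({w : InfinitePlace K // w.IsComplex} × Fin 2) × Fin n × Fin n)).length +
        (wordOfFinset hcpt S ++ L).length ≤ m := fun S ↦ by
    rw [List.length_nil, zero_add, List.length_append, length_wordOfFinset, hm]
    have : S.card ≤ Module.finrank ℝ (Matrix (Fin n) (Fin n) (mixedSpace K)) := by
      simpa using S.card_le_univ
    omega
  have hΛ' : ∀ y, ∀ u ∈ T, ‖cutoffWeightMap hcpt hWc 0 y u‖ ≤
      (Λ₀ * (1 ⊔ (AutomorphyDatum.gl n K hcpt).height y) ^ r) * coordSize bT u := hΛ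
  choose Kc hKc0 hKc using fun S : Finset (GlIdx n K) ↦
    hW.exists_norm_cutoffWeightMap_iterW_le (SelfDualUnits.mixedSpace K) bT hT
      (Λ := fun y ↦ Λ₀ * (1 ⊔ (AutomorphyDatum.gl n K hcpt).height y) ^ r) (fun y ↦ by positivity) hΛ' hφT m
      (wordOfFinset hcpt S ++ L) [] (hlen S)
  refine ⟨Csob * ∑ S : Finset (GlIdx n K), (1 + (Kc S * Λ₀ * coordSize bT ⟨φ, hφ⟩) ^ 2), fun g ↦ ?_⟩
  have hg1 : (1 : ℝ) ≤ 1 ⊔ (AutomorphyDatum.gl n K hcpt).height g := le_sup_left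
  have hpow1 : (1 : ℝ) ≤ (1 ⊔ (AutomorphyDatum.gl n K hcpt).height g) ^ (2 * r) := one_le_pow₀ hg1
  refine (hsob _ hGsm hGc g m).trans ?_
  rw [mul_assoc, Finset.sum_mul]
  refine mul_le_mul_of_nonneg_left (Finset.sum_le_sum fun S _ ↦ ?_) hCsob0
  -- the weight of `X_S (L φ)` is the weight map of `iterW (X_S ++ L) φ`
  have e : cutoffWeightLp hcpt m g (hGc (wordOfFinset hcpt S)) =
      cutoffWeightMap hcpt hWc m g (hW.iterW (List.map (unitGenD (SelfDualUnits.mixedSpace K) hcpt) [] ++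
        (wordOfFinset hcpt S ++ L)) ⟨φ, hφ⟩) := by
    rw [cutoffWeightMap_apply]
    exact cutoffWeightLp_congr m g _ _ (by
      rw [IsStableSubmodule.coe_iterW, List.map_nil, List.nil_append, iterLieDeriv_append])
  have hb := hKc S g
  rw [← e] at hb
  have hK0 : 0 ≤ Kc S * Λ₀ * coordSize bT ⟨φ, hφ⟩ := mul_nonneg (mul_nonneg (hKc0 S) hΛ₀) (coordSize_nonneg bT _)
  have hb' : ‖cutoffWeightLp hcpt m g (hGc (wordOfFinset hcpt S))‖ ≤
      Kc S * Λ₀ * coordSize bT ⟨φ, hφ⟩ * (1 ⊔ (AutomorphyDatum.gl n K hcpt).height g) ^ r := by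
    refine hb.trans (le_of_eq ?_); ring
  calc 1 + ‖cutoffWeightLp hcpt m g (hGc (wordOfFinset hcpt S))‖ ^ 2
      ≤ 1 + (Kc S * Λ₀ * coordSize bT ⟨φ, hφ⟩ * (1 ⊔ (AutomorphyDatum.gl n K hcpt).height g) ^ r) ^ 2 :=
        add_le_add le_rfl (pow_le_pow_left₀ (norm_nonneg _) hb' 2)
    _ = 1 + (Kc S * Λ₀ * coordSize bT ⟨φ, hφ⟩) ^ 2 * (1 ⊔ (AutomorphyDatum.gl n K hcpt).height g) ^ (2 * r) := by ring
    _ ≤ (1 + (Kc S * Λ₀ * coordSize bT ⟨φ, hφ⟩) ^ 2) * (1 ⊔ (AutomorphyDatum.gl n K hcpt).height g) ^ (2 * r) := by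
        rw [add_mul, one_mul]
        exact add_le_add hpow1 le_rfl

/-- **Elements of stable spaces of automorphic forms on `GL_n(𝔸_K)` have uniformly moderate growth**
(Borel–Jacquet 1979, 4.3 (ii) / Moeglin–Waldspurger 1995, I.2.17, for the elements of a
`(𝔤, K_∞) × GL_n(𝔸_K^∞)`-stable space of automorphic forms): for `φ ∈ W` there is ONE exponent
`r` such that every derivative `p φ`, `p ∈ ℝ⟨𝔤⟩`, satisfies `‖p φ (g)‖ ≤ C_p (1 ⊔ ‖g‖)^r`
(`HasUniformModerateGrowth`). PROVED without Harish-Chandra's convolution identity or elliptic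
regularity: `exists_exponent_norm_iterLieDeriv_le` on the words of `p`. This is the input of the
rapid decay of cusp forms on Siegel sets (`IsCuspFormGL.isRapidlyDecreasingGL_of_hasUniformModerateGrowth`).
[cite: BorelJacquetCorvallis1979, 4.3 (ii)] -/
theorem IsStableSubmodule.hasUniformModerateGrowth_of_mem (hW : IsStableSubmodule (AutomorphyDatum.gl n K hcpt) W)
    {φ : (AdelicGroupData.gl n K).Adelic → ℂ} (hφ : φ ∈ W) : HasUniformModerateGrowth (AutomorphyDatum.gl n K hcpt) φ := by
  obtain ⟨r, hr⟩ := hW.exists_exponent_norm_iterLieDeriv_le hφ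
  refine ⟨r, fun p ↦ ?_⟩
  choose B hB using hr
  refine ⟨∑ w ∈ ((FreeAlgebra.basisFreeMonoid ℝ (AutomorphyDatum.gl n K hcpt).arch.lie).repr p).support,
    ‖(((FreeAlgebra.basisFreeMonoid ℝ (AutomorphyDatum.gl n K hcpt).arch.lie).repr p) w : ℂ)‖ * B (FreeMonoid.toList w), fun g ↦ ?_⟩
  rw [applyFree, Finsupp.sum, Finset.sum_apply, Finset.sum_mul]
  refine (norm_sum_le _ _).trans (Finset.sum_le_sum fun w _ ↦ ?_)
  rw [Pi.smul_apply, _root_.norm_smul, mul_assoc]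
  exact mul_le_mul_of_nonneg_left (hB _ g) (norm_nonneg _)

end Growth

end Literature.NumberTheory.Automorphic
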